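import Literature.Analysis.FluidPDE.PineauVicolPressureIdentification
import Literature.Analysis.FluidPDE.NormalisedPressureL2Bound
import Literature.Analysis.FluidPDE.NewtonPotentialHolder
import HarnessLib

/-!
# The local pressure mass of a rescaled Type I solution (Pineau–Vicol 2026, Lemma 7.1: the pressure input)

Analysis/FluidPDE support file (all results proved; no named facts) in the discharge programme of
`Literature.Analysis.FluidPDE.pineauVicol2026_rdss_liouville` (B. Pineau, V. Vicol,
arXiv:2607.09619 (2026), Thm. 1.7). Lemma 7.1 (p. 24) rescales the Type I solution to a unit
parabolic cylinder `Q₁` around `(x*, t*)`, `r = c e^{−s/2} max{|y|,1}`, where `|ũ| ≤ C_{U,0}`,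
and invokes quantitative interior regularity with constants depending on `C_{U,0}` only. The
source's estimate is pressure-free (footnote 14); the tree's quantitative bootstrap
(`NSBootstrap.exists_smooth_holder_rep_norm`, Serrin/Seregin–Šverák) needs the cylinder mass
`∫∫_{Q₁}|p̃|^{3/2}` of the pressure. By `PineauVicolPressureIdentification` the pressure is the
potential `Q[ũ(t̃)]` up to a function of time, and globally the rescaled slice only obeys the
near-singular profile bound `|ũ(x̃)| ≤ C₀/(|x̃ − y₀| + s₀)` with the parabolic vertex `y₀` on the
sphere of radius `16` (cylinder scale `c = 1/16`) or else `s₀ ≥ 16 − |y₀|`. This file bounds the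
local `L²` mass of `Q[v]` for such profiles by an absolute multiple of `C₀⁴`:

* `integral_closedBall_indicator_norm_sub_inv_sq_le`: `∫_{B̄(y₀,ρ)}|y−y₀|⁻² ≤ 12|B₁|ρ`
  (`NewtonPotentialHolder.integral_ball_norm_rpow_neg`);
* `exists_bound_farPotential_profile`: `|Q₂^{1,2}[v](x)| ≤ K C₀²` on `B̄₁` (near the vertex the
  kernel is bounded and `|v|² ≤ C₀²|y−y₀|⁻²` is locally integrable; away from it `v` is in the
  decay class with constant `10 C₀`);
* `pressureSource_congr_of_eventuallyEq`, `nearPotential_congr`: the near potential is local;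
* `exists_local_pressure_mass_bound`: `∫_{B̄₁}|Q[v]|² ≤ K C₀⁴` — cut `w = χ v` (`χ ≡ 1` on
  `B̄₄`, `supp ⊆ B̄₈`, `|w| ≤ C₀/8`), `Q[v] = Q[w] + Q₂[w] − Q₂[v]` on `B̄₁`, and `Q[w] = p̃[w]`
  with the tree's `L²` Calderón–Zygmund bound `‖p̃[w]‖₂ ≤ C_S‖|w|²‖₂`
  (`stein1970_normalisedPressure_eLpNorm_le_holds`, proved there).

## References

* B. Pineau, V. Vicol, arXiv:2607.09619 (2026), Lemma 7.1 and its proof (p. 24), footnotes 14,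
  21, 22; Lemma 2.1. [PineauVicol2026]
* T. Tao, Anal. PDE 6 (2013), (35) (the normalised pressure). [Tao2011]
* E. M. Stein, *Singular Integrals and Differentiability Properties of Functions* (1970/71),
  Ch. II §4.2 Thm. 3 (the `L²` bound, as proved in the tree). [Stein1971]
-/

noncomputable section

open MeasureTheory Set Filter Metric Topology InnerProductSpace Function
open scoped RealInnerProductSpace Laplacian ContDiff ENNReal

namespace Literature.Analysis.FluidPDE

namespace PineauVicol2026

open Literature.Analysis.FluidPDE.FourierNS (HasDecay)
open Literature.Analysis.FluidPDE.NewtonPotentialHolder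

/-- Local notation for physical space `ℝ³ = EuclideanSpace ℝ (Fin 3)`. -/
local notation "ℝ³" => EuclideanSpace ℝ (Fin 3)

-- nested operator types `ℝ³ →L[ℝ] ℝ³ →L[ℝ] ℝ`
set_option maxSynthPendingDepth 3

/-- `∫_{B̄(y₀,ρ)} |y − y₀|⁻² dy ≤ 12 |B₁| ρ` (`= ∫_{B_ρ}|z|⁻²` up to the null sphere). [folklore] -/
theorem integral_closedBall_indicator_norm_sub_inv_sq_le (y₀ : ℝ³) {ρ : ℝ} (hρ : 0 < ρ) :
    Integrable (fun y : ℝ³ => (closedBall y₀ ρ).indicator (fun y => (‖y - y₀‖ ^ 2)⁻¹) y) ∧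
    ∫ y, (closedBall y₀ ρ).indicator (fun y => (‖y - y₀‖ ^ 2)⁻¹) y ≤
      3 * (volume : Measure ℝ³).real (ball 0 1) * (2 * ρ) := by
  -- compare with `‖z‖^{-2}` on the ball of radius `2ρ`
  have hI := integrableOn_ball_norm_rpow_neg (s := 2) (by norm_num) (2 * ρ)
  have hval := integral_ball_norm_rpow_neg (s := 2) (by norm_num) (by positivity : (0:ℝ) < 2 * ρ)
  have hsub : closedBall (0 : ℝ³) ρ ⊆ ball 0 (2 * ρ) := closedBall_subset_ball (by linarith)
  have e : (fun y : ℝ³ => (closedBall y₀ ρ).indicator (fun y => (‖y - y₀‖ ^ 2)⁻¹) y) =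
      fun y => (closedBall (0 : ℝ³) ρ).indicator (fun z => (‖z‖ ^ 2)⁻¹) (y - y₀) := by
    funext y
    by_cases hy : y ∈ closedBall y₀ ρ
    · have : y - y₀ ∈ closedBall (0 : ℝ³) ρ := by
        rw [mem_closedBall_zero_iff]; rwa [mem_closedBall, dist_eq_norm] at hy
      rw [Set.indicator_of_mem hy, Set.indicator_of_mem this]
    · have : y - y₀ ∉ closedBall (0 : ℝ³) ρ := by
        rw [mem_closedBall_zero_iff]; rwa [mem_closedBall, dist_eq_norm] at hy
      rw [Set.indicator_of_notMem hy, Set.indicator_of_notMem this]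
  have hpow : ∀ z : ℝ³, (‖z‖ ^ 2)⁻¹ = ‖z‖ ^ (-(2 : ℝ)) := fun z => by
    rw [Real.rpow_neg (norm_nonneg _), show (2 : ℝ) = ((2 : ℕ) : ℝ) by norm_num, Real.rpow_natCast]
  have hI0 : Integrable (fun z : ℝ³ => (closedBall (0 : ℝ³) ρ).indicator (fun z => (‖z‖ ^ 2)⁻¹) z) := by
    rw [integrable_indicator_iff measurableSet_closedBall]
    refine (hI.mono_set hsub).congr (Eventually.of_forall fun z => (hpow z).symm)
  rw [e]
  refine ⟨hI0.comp_sub_right y₀, ?_⟩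
  rw [integral_sub_right_eq_self (fun z => (closedBall (0 : ℝ³) ρ).indicator (fun z => (‖z‖ ^ 2)⁻¹) z) y₀,
    integral_indicator measurableSet_closedBall]
  calc ∫ z in closedBall (0 : ℝ³) ρ, (‖z‖ ^ 2)⁻¹ ≤ ∫ z in ball (0 : ℝ³) (2 * ρ), (‖z‖ ^ 2)⁻¹ :=
        setIntegral_mono_set (hI.congr (Eventually.of_forall fun z => (hpow z).symm))
          (Eventually.of_forall fun z => by positivity) hsub.eventuallyLE
    _ = ∫ z in ball (0 : ℝ³) (2 * ρ), ‖z‖ ^ (-(2 : ℝ)) := by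
        refine setIntegral_congr_fun measurableSet_ball fun z _ => hpow z
    _ = 3 * (volume : Measure ℝ³).real (ball 0 1) * (2 * ρ) := by
        rw [hval]; norm_num

/-- **The far potential of a near-singular Type I profile is bounded near the origin.** There is
an absolute `K` such that for `v` continuous with `|v(x)| ≤ C₀/(|x − y₀| + s₀)`, `s₀ > 0`,
`|y₀| ≤ 16` and `|y₀| + s₀ ≥ 16` (the rescaled Type I velocity seen from a parabolic cylinder of
Lemma 7.1: either the parabolic vertex `y₀` sits on the sphere of radius `16`, or the profile is
regular, `s₀ ≥ 16 − |y₀|`), `|Q₂^{1,2}[v](x)| ≤ K C₀²` for all `|x| ≤ 1`: near the vertex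
`‖D²Γ∞‖ ≤ m₂` against `∫_{B̄(y₀,2)}|y−y₀|⁻² = O(1)`; away from it `|v(y)| ≤ 10 C₀/(1+|y|)` and the
decay-class estimate applies. [folklore] -/
theorem exists_bound_farPotential_profile :
    ∃ K : ℝ, 0 ≤ K ∧ ∀ (v : ℝ³ → ℝ³) (C₀ s₀ : ℝ) (y₀ : ℝ³), Continuous v → 0 < s₀ → ‖y₀‖ ≤ 16 →
      16 ≤ ‖y₀‖ + s₀ → (∀ x, ‖v x‖ ≤ C₀ / (‖x - y₀‖ + s₀)) →
      ∀ x ∈ closedBall (0 : ℝ³) 1, |farPotential 1 2 v x| ≤ K * C₀ ^ 2 := by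
  -- constants
  obtain ⟨m₂, -, -, hm₂, -, -⟩ := exists_bounds_fderiv2_newtonFar (r₀ := (1 : ℝ)) (r₁ := 2) one_pos one_lt_two
  have hm₂0 : 0 ≤ m₂ := (norm_nonneg _).trans (hm₂ 0)
  obtain ⟨M2, hM20, hM2⟩ := exists_decay_of_homogeneous _ (-3) (by norm_num) fderiv2_newtonKernel_homogeneous
    (contDiffOn_fderiv2_newtonKernel (n := 0)).continuousOn
  set V₁ : ℝ := volume.real (Metric.ball (0 : ℝ³) 1) with hV₁
  have hV₁0 : 0 ≤ V₁ := measureReal_nonneg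
  set Vc : ℝ := volume.real (Metric.closedBall (0 : ℝ³) 1) with hVc
  have hVc0 : 0 ≤ Vc := measureReal_nonneg
  set K₆ : ℝ := ∫ y : ℝ³, ((1 + ‖y‖) ^ 6)⁻¹ with hK₆
  set K₄ : ℝ := ∫ y : ℝ³, ((1 + ‖y‖) ^ 4)⁻¹ with hK₄
  have hK₆0 : 0 ≤ K₆ := integral_nonneg fun y => by positivity
  have hK₄0 : 0 ≤ K₄ := integral_nonneg fun y => by positivity
  -- the decay-class constant away from the vertex: `(19/2)² ≤ 100`
  refine ⟨m₂ * (3 * V₁ * 4) + 100 * (8 * m₂ * Vc + M2 / 2 * ((3 / 2) ^ 6 * K₆ + K₄)), by positivity,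
    fun v C₀ s₀ y₀ hvc hs₀ hy₀ hys hv x hx => ?_⟩
  have hC : 0 ≤ C₀ := by
    have := (norm_nonneg _).trans (hv y₀)
    rw [sub_self, norm_zero, zero_add] at this
    exact (div_nonneg_iff.1 this).elim (fun h => h.1) fun h => absurd h.2 (not_le.2 hs₀)
  have hx1 : ‖x‖ ≤ 1 := mem_closedBall_zero_iff.1 hx
  -- kernel facts
  have hkerFar : ∀ z, 2 < ‖z‖ → ‖fderiv ℝ (fderiv ℝ (newtonFar 1 2)) z‖ ≤ M2 * (‖z‖ ^ 3)⁻¹ := by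
    intro z hz
    rw [(newtonFar_fderiv_iterates_eq zero_le_one one_lt_two hz).2.2.1]
    have := hM2 z (by linarith)
    rwa [show (-3 : ℤ) = -((3 : ℕ) : ℤ) by norm_num, zpow_neg, zpow_natCast] at this
  -- the two weight regimes
  set B : Set ℝ³ := closedBall y₀ 2 with hB
  have hvB : ∀ y, ‖v y‖ ^ 2 ≤ C₀ ^ 2 * (‖y - y₀‖ ^ 2)⁻¹ ∨ y = y₀ := by
    intro y
    by_cases hy : y = y₀
    · exact Or.inr hy
    · left
      have hpos : 0 < ‖y - y₀‖ := norm_pos_iff.2 (sub_ne_zero.2 hy)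
      have h1 : ‖v y‖ ≤ C₀ / ‖y - y₀‖ :=
        (hv y).trans (div_le_div_of_nonneg_left hC hpos (by linarith))
      calc ‖v y‖ ^ 2 ≤ (C₀ / ‖y - y₀‖) ^ 2 := pow_le_pow_left₀ (norm_nonneg _) h1 2
        _ = C₀ ^ 2 * (‖y - y₀‖ ^ 2)⁻¹ := by rw [div_pow, div_eq_mul_inv]
  have hvA : ∀ y, y ∉ B → ‖v y‖ ≤ 10 * C₀ / (1 + ‖y‖) := by
    intro y hy
    have hyy : 2 < ‖y - y₀‖ := by rwa [hB, mem_closedBall, dist_eq_norm, not_le] at hy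
    have hpos : 0 < ‖y - y₀‖ := by linarith
    have h1 : ‖v y‖ ≤ C₀ / ‖y - y₀‖ := (hv y).trans (div_le_div_of_nonneg_left hC hpos (by linarith))
    have h2 : 1 + ‖y‖ ≤ 10 * ‖y - y₀‖ := by
      have : ‖y‖ ≤ ‖y₀‖ + ‖y - y₀‖ := by
        have := norm_add_le y₀ (y - y₀); rwa [add_sub_cancel] at this
      linarith
    rw [le_div_iff₀ (by positivity)]
    calc ‖v y‖ * (1 + ‖y‖) ≤ C₀ / ‖y - y₀‖ * (10 * ‖y - y₀‖) := mul_le_mul h1 h2 (by positivity) (by positivity)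
      _ = 10 * C₀ := by field_simp
  -- the dominator
  set C' : ℝ := 10 * C₀ with hC'
  set g : ℝ³ → ℝ := fun y =>
    m₂ * C₀ ^ 2 * B.indicator (fun y => (‖y - y₀‖ ^ 2)⁻¹) y +
    (m₂ * C' ^ 2 * (closedBall x 2).indicator (fun _ => (1 : ℝ)) y +
      M2 / 2 * C' ^ 2 * ((3 / 2) ^ 6 * ((1 + ‖x - y‖) ^ 6)⁻¹ + ((1 + ‖y‖) ^ 4)⁻¹)) with hg
  obtain ⟨hBi, hBint⟩ := integral_closedBall_indicator_norm_sub_inv_sq_le y₀ two_pos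
  have hball_fin : volume (closedBall x 2) < ⊤ := measure_closedBall_lt_top
  have hI1i : Integrable (fun y : ℝ³ => m₂ * C' ^ 2 * (closedBall x 2).indicator (fun _ => (1 : ℝ)) y) :=
    ((integrableOn_const hball_fin.ne (C := (1 : ℝ))).integrable_indicator measurableSet_closedBall).const_mul _
  have hI2i : Integrable (fun y : ℝ³ => M2 / 2 * C' ^ 2 * ((3 / 2) ^ 6 * ((1 + ‖x - y‖) ^ 6)⁻¹ + ((1 + ‖y‖) ^ 4)⁻¹)) :=
    ((((integrable_inv_one_add_norm_pow (k := 6) (by norm_num)).comp_sub_left x).const_mul _).add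
      (integrable_inv_one_add_norm_pow (k := 4) le_rfl)).const_mul _
  have hgi : Integrable g := by
    rw [hg]; exact (hBi.const_mul _).add (hI1i.add hI2i)
  -- pointwise domination off the null set `{y₀}`
  have hpt : ∀ y, y ≠ y₀ → ‖fderiv ℝ (fderiv ℝ (newtonFar 1 2)) (x - y) (v y) (v y)‖ ≤ g y := by
    intro y hyy₀
    have hbase : ‖fderiv ℝ (fderiv ℝ (newtonFar 1 2)) (x - y) (v y) (v y)‖ ≤
        ‖fderiv ℝ (fderiv ℝ (newtonFar 1 2)) (x - y)‖ * ‖v y‖ ^ 2 := by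
      calc _ ≤ ‖fderiv ℝ (fderiv ℝ (newtonFar 1 2)) (x - y) (v y)‖ * ‖v y‖ :=
            ContinuousLinearMap.le_opNorm _ _
        _ ≤ ‖fderiv ℝ (fderiv ℝ (newtonFar 1 2)) (x - y)‖ * ‖v y‖ * ‖v y‖ := by
            gcongr; exact ContinuousLinearMap.le_opNorm _ _
        _ = _ := by ring
    have hg1 : 0 ≤ m₂ * C₀ ^ 2 * B.indicator (fun y => (‖y - y₀‖ ^ 2)⁻¹) y := by
      refine mul_nonneg (by positivity) (Set.indicator_nonneg (fun y _ => by positivity) y)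
    have hg2 : 0 ≤ m₂ * C' ^ 2 * (closedBall x 2).indicator (fun _ => (1 : ℝ)) y +
        M2 / 2 * C' ^ 2 * ((3 / 2) ^ 6 * ((1 + ‖x - y‖) ^ 6)⁻¹ + ((1 + ‖y‖) ^ 4)⁻¹) := by
      refine add_nonneg (mul_nonneg (by positivity) (Set.indicator_nonneg (fun y _ => zero_le_one) y)) (by positivity)
    by_cases hyB : y ∈ B
    · -- near the vertex
      rcases hvB y with hvy | hvy
      · have : ‖fderiv ℝ (fderiv ℝ (newtonFar 1 2)) (x - y)‖ * ‖v y‖ ^ 2 ≤ m₂ * (C₀ ^ 2 * (‖y - y₀‖ ^ 2)⁻¹) :=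
          mul_le_mul (hm₂ _) hvy (sq_nonneg _) hm₂0
        have hgy : m₂ * C₀ ^ 2 * B.indicator (fun y => (‖y - y₀‖ ^ 2)⁻¹) y = m₂ * (C₀ ^ 2 * (‖y - y₀‖ ^ 2)⁻¹) := by
          rw [Set.indicator_of_mem hyB]; ring
        rw [hg]; dsimp only
        linarith [hbase]
      · exact absurd hvy hyy₀
    · -- away from the vertex: the decay-class computation with `C' = 10 C₀`
      have hvy : ‖v y‖ ^ 2 ≤ C' ^ 2 / (1 + ‖y‖) ^ 2 := by
        rw [← div_pow]; exact pow_le_pow_left₀ (norm_nonneg _) (by rw [hC']; exact hvA y hyB) 2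
      have h1y : 0 < 1 + ‖y‖ := by positivity
      have hvy' : ‖v y‖ ^ 2 ≤ C' ^ 2 := hvy.trans (div_le_self (sq_nonneg _) (one_le_pow₀ (by linarith [norm_nonneg y])))
      have hfar_part : ‖fderiv ℝ (fderiv ℝ (newtonFar 1 2)) (x - y)‖ * ‖v y‖ ^ 2 ≤
          m₂ * C' ^ 2 * (closedBall x 2).indicator (fun _ => (1 : ℝ)) y +
            M2 / 2 * C' ^ 2 * ((3 / 2) ^ 6 * ((1 + ‖x - y‖) ^ 6)⁻¹ + ((1 + ‖y‖) ^ 4)⁻¹) := by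
        by_cases hy : y ∈ closedBall x 2
        · rw [Set.indicator_of_mem hy, mul_one]
          have : ‖fderiv ℝ (fderiv ℝ (newtonFar 1 2)) (x - y)‖ * ‖v y‖ ^ 2 ≤ m₂ * C' ^ 2 :=
            mul_le_mul (hm₂ _) hvy' (sq_nonneg _) hm₂0
          have : 0 ≤ M2 / 2 * C' ^ 2 * ((3 / 2) ^ 6 * ((1 + ‖x - y‖) ^ 6)⁻¹ + ((1 + ‖y‖) ^ 4)⁻¹) := by positivity
          linarith
        · rw [Set.indicator_of_notMem hy, mul_zero, zero_add]
          have hxy : 2 < ‖x - y‖ := by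
            rw [mem_closedBall, dist_comm, dist_eq_norm, not_le] at hy; exact hy
          have hk := hkerFar (x - y) hxy
          have h1xy : 0 < 1 + ‖x - y‖ := by positivity
          have hcmp : (‖x - y‖ ^ 3)⁻¹ ≤ (3 / 2) ^ 3 * ((1 + ‖x - y‖) ^ 3)⁻¹ := by
            have hle : (1 + ‖x - y‖) ^ 3 ≤ ((3 / 2) * ‖x - y‖) ^ 3 :=
              pow_le_pow_left₀ h1xy.le (by linarith) 3
            rw [inv_eq_one_div, inv_eq_one_div, mul_one_div, div_le_div_iff₀ (by positivity) (by positivity), one_mul]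
            calc (1 + ‖x - y‖) ^ 3 ≤ ((3 / 2) * ‖x - y‖) ^ 3 := hle
              _ = (3 / 2) ^ 3 * ‖x - y‖ ^ 3 := by ring
          set a : ℝ := (3 / 2) ^ 3 * ((1 + ‖x - y‖) ^ 3)⁻¹ with ha
          set b : ℝ := ((1 + ‖y‖) ^ 2)⁻¹ with hb
          have hab : a * b ≤ (1 / 2) * (a ^ 2 + b ^ 2) := by nlinarith [sq_nonneg (a - b)]
          have ha2 : a ^ 2 = (3 / 2) ^ 6 * ((1 + ‖x - y‖) ^ 6)⁻¹ := by
            rw [ha, mul_pow, inv_pow, ← pow_mul, ← pow_mul]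
          have hb2 : b ^ 2 = ((1 + ‖y‖) ^ 4)⁻¹ := by rw [hb, inv_pow, ← pow_mul]
          calc ‖fderiv ℝ (fderiv ℝ (newtonFar 1 2)) (x - y)‖ * ‖v y‖ ^ 2
              ≤ (M2 * (‖x - y‖ ^ 3)⁻¹) * (C' ^ 2 / (1 + ‖y‖) ^ 2) :=
                mul_le_mul hk hvy (sq_nonneg _) (by positivity)
            _ ≤ (M2 * a) * (C' ^ 2 * b) := by
                rw [hb, div_eq_mul_inv]
                exact mul_le_mul_of_nonneg_right (mul_le_mul_of_nonneg_left hcmp hM20) (by positivity)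
            _ = M2 * C' ^ 2 * (a * b) := by ring
            _ ≤ M2 * C' ^ 2 * ((1 / 2) * (a ^ 2 + b ^ 2)) := mul_le_mul_of_nonneg_left hab (by positivity)
            _ = M2 / 2 * C' ^ 2 * ((3 / 2) ^ 6 * ((1 + ‖x - y‖) ^ 6)⁻¹ + ((1 + ‖y‖) ^ 4)⁻¹) := by
                rw [ha2, hb2]; ring
      rw [hg]; dsimp only
      linarith [hbase, hfar_part]
  have hae : ∀ᵐ y ∂(volume : Measure ℝ³), ‖fderiv ℝ (fderiv ℝ (newtonFar 1 2)) (x - y) (v y) (v y)‖ ≤ g y := by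
    have h0 : (volume : Measure ℝ³) {y₀} = 0 := measure_singleton y₀
    rw [ae_iff]
    refine measure_mono_null (fun y hy => ?_) h0
    by_contra hne
    exact hy (hpt y hne)
  -- integrate
  have hvol : volume.real (closedBall x 2) = 2 ^ 3 * Vc := by
    rw [hVc, measureReal_def, measureReal_def, Measure.addHaar_closedBall volume x (by norm_num : (0:ℝ) ≤ 2),
      Measure.addHaar_closedBall volume (0 : ℝ³) zero_le_one, ENNReal.toReal_mul, ENNReal.toReal_ofReal (by norm_num)]
    simp
  have hK₆' : ∫ y : ℝ³, ((1 + ‖x - y‖) ^ 6)⁻¹ = K₆ := by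
    rw [hK₆]; exact integral_sub_left_eq_self (fun z : ℝ³ => ((1 + ‖z‖) ^ 6)⁻¹) volume x
  have hI1 : ∫ y : ℝ³, m₂ * C' ^ 2 * (closedBall x 2).indicator (fun _ => (1 : ℝ)) y = m₂ * C' ^ 2 * (2 ^ 3 * Vc) := by
    rw [integral_const_mul, integral_indicator measurableSet_closedBall, setIntegral_const, smul_eq_mul, mul_one, hvol]
  have hI2 : ∫ y : ℝ³, M2 / 2 * C' ^ 2 * ((3 / 2) ^ 6 * ((1 + ‖x - y‖) ^ 6)⁻¹ + ((1 + ‖y‖) ^ 4)⁻¹) =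
      M2 / 2 * C' ^ 2 * ((3 / 2) ^ 6 * K₆ + K₄) := by
    have i6 : Integrable (fun y : ℝ³ => (3 / 2 : ℝ) ^ 6 * ((1 + ‖x - y‖) ^ 6)⁻¹) :=
      ((integrable_inv_one_add_norm_pow (k := 6) (by norm_num)).comp_sub_left x).const_mul _
    have i4 : Integrable (fun y : ℝ³ => ((1 + ‖y‖) ^ 4)⁻¹) := integrable_inv_one_add_norm_pow (k := 4) le_rfl
    rw [integral_const_mul, integral_add i6 i4, integral_const_mul, hK₆']
  have hI0 : ∫ y : ℝ³, m₂ * C₀ ^ 2 * B.indicator (fun y => (‖y - y₀‖ ^ 2)⁻¹) y ≤ m₂ * C₀ ^ 2 * (3 * V₁ * (2 * 2)) := by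
    rw [integral_const_mul]
    exact mul_le_mul_of_nonneg_left hBint (by positivity)
  calc |farPotential 1 2 v x| = ‖∫ y, fderiv ℝ (fderiv ℝ (newtonFar 1 2)) (x - y) (v y) (v y)‖ := by
        rw [Real.norm_eq_abs]; rfl
    _ ≤ ∫ y, g y := norm_integral_le_of_norm_le hgi hae
    _ = (∫ y, m₂ * C₀ ^ 2 * B.indicator (fun y => (‖y - y₀‖ ^ 2)⁻¹) y) +
          ((∫ y, m₂ * C' ^ 2 * (closedBall x 2).indicator (fun _ => (1 : ℝ)) y) +
            ∫ y, M2 / 2 * C' ^ 2 * ((3 / 2) ^ 6 * ((1 + ‖x - y‖) ^ 6)⁻¹ + ((1 + ‖y‖) ^ 4)⁻¹)) := by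
        have hB' : Integrable (fun y : ℝ³ => m₂ * C₀ ^ 2 * B.indicator (fun y => (‖y - y₀‖ ^ 2)⁻¹) y) := hBi.const_mul _
        have hsum : Integrable (fun y : ℝ³ => m₂ * C' ^ 2 * (closedBall x 2).indicator (fun _ => (1 : ℝ)) y +
            M2 / 2 * C' ^ 2 * ((3 / 2) ^ 6 * ((1 + ‖x - y‖) ^ 6)⁻¹ + ((1 + ‖y‖) ^ 4)⁻¹)) := hI1i.add hI2i
        rw [hg]; dsimp only
        rw [integral_add hB' hsum, integral_add hI1i hI2i]
    _ ≤ m₂ * C₀ ^ 2 * (3 * V₁ * (2 * 2)) + (m₂ * C' ^ 2 * (2 ^ 3 * Vc) + M2 / 2 * C' ^ 2 * ((3 / 2) ^ 6 * K₆ + K₄)) := by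
        rw [hI1, hI2]; exact add_le_add hI0 le_rfl
    _ = (m₂ * (3 * V₁ * 4) + 100 * (8 * m₂ * Vc + M2 / 2 * ((3 / 2) ^ 6 * K₆ + K₄))) * C₀ ^ 2 := by
        rw [hC']; ring

/-! ### Locality of the near potential -/

/-- The pressure source `∂ᵢ∂ⱼ(vᵢvⱼ)` is a local (differential) expression: it agrees at `y` for
two fields agreeing near `y`. [folklore] -/
theorem pressureSource_congr_of_eventuallyEq {v w : ℝ³ → ℝ³} {y : ℝ³} (h : v =ᶠ[𝓝 y] w) :
    pressureSource v y = pressureSource w y := by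
  -- the field whose divergence is the source agrees near `y`
  have hF : (fun z => FluidPDE.convect v v z + VectorCalculus.divergence v z • v z) =ᶠ[𝓝 y]
      fun z => FluidPDE.convect w w z + VectorCalculus.divergence w z • w z := by
    -- `h` holds on a neighbourhood, on which the pointwise identities hold
    have h' : ∀ᶠ z in 𝓝 y, v =ᶠ[𝓝 z] w := h.eventuallyEq_nhds
    filter_upwards [h', h] with z hz hz0
    have hD : fderiv ℝ v z = fderiv ℝ w z := hz.fderiv_eq
    have hdiv : VectorCalculus.divergence v z = VectorCalculus.divergence w z := by
      unfold VectorCalculus.divergence; rw [hD]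
    rw [FluidPDE.convect_apply, FluidPDE.convect_apply, hD, hz0, hdiv]
  show VectorCalculus.divergence (fun z => FluidPDE.convect v v z + VectorCalculus.divergence v z • v z) y =
    VectorCalculus.divergence (fun z => FluidPDE.convect w w z + VectorCalculus.divergence w z • w z) y
  unfold VectorCalculus.divergence
  rw [show fderiv ℝ (fun z => FluidPDE.convect v v z + (LinearMap.trace ℝ ℝ³) ↑(fderiv ℝ v z) • v z) y =
      fderiv ℝ (fun z => FluidPDE.convect w w z + (LinearMap.trace ℝ ℝ³) ↑(fderiv ℝ w z) • w z) y from hF.fderiv_eq]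

/-- **Locality of the near potential.** If `v = w` on a neighbourhood of the closed ball
`B̄(x, 2)`, then `Q₁^{1,2}[v](x) = Q₁^{1,2}[w](x)` (`Γ₀^{1,2}` vanishes off `B(0,2)` and the
source is local). [folklore] -/
theorem nearPotential_congr {v w : ℝ³ → ℝ³} {x : ℝ³} {r : ℝ} (hr : 2 < r)
    (h : ∀ y ∈ ball x r, v y = w y) : nearPotential 1 2 v x = nearPotential 1 2 w x := by
  rw [nearPotential, nearPotential]
  refine integral_congr_ae (Eventually.of_forall fun z => ?_)
  by_cases hz : ‖z‖ < 2
  · have hmem : x - z ∈ ball x r := by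
      rw [mem_ball, dist_eq_norm, sub_sub_cancel_left, norm_neg]; linarith
    have hev : v =ᶠ[𝓝 (x - z)] w := by
      filter_upwards [isOpen_ball.mem_nhds hmem] with y hy
      exact h y hy
    simp only
    rw [pressureSource_congr_of_eventuallyEq hev]
  · rw [not_lt] at hz
    simp only
    rw [newtonNear_eq_zero zero_le_one one_lt_two hz, zero_mul, zero_mul]

/-- `‖f‖_{L²}² = ∫ ‖f‖²` for `f ∈ L²` (real-valued integral form). [folklore] -/
theorem integral_norm_sq_eq_of_memLp_two {F : Type*} [NormedAddCommGroup F] {f : ℝ³ → F}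
    (hf : MemLp f 2 volume) : (eLpNorm f 2 volume).toReal ^ 2 = ∫ x, ‖f x‖ ^ 2 := by
  rw [hf.eLpNorm_eq_integral_rpow_norm (by norm_num) (by simp)]
  have hI : 0 ≤ ∫ a, ‖f a‖ ^ 2 := integral_nonneg fun _ => sq_nonneg _
  simp only [ENNReal.toReal_ofNat]
  rw [ENNReal.toReal_ofReal (by positivity)]
  have := Real.rpow_inv_natCast_pow hI (n := 2) (by norm_num)
  simpa using this

/-! ### The local pressure mass of a near-singular Type I profile -/

/-- **Local `L²` pressure mass (plan (II-a)).** There is an absolute `K` such that for every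
smooth `v` with `|v(x)| ≤ C₀/(|x − y₀| + s₀)` (`s₀ > 0`, `|y₀| ≤ 16`, `|y₀| + s₀ ≥ 16`),
`∫_{B̄₁} |Q[v]|² ≤ K C₀⁴`. Proof: cut `w = χv` with `χ ≡ 1` on `B̄₄`, `supp χ ⊆ B̄₈` (so
`|w| ≤ C₀/8`); on `B̄₁`, `Q₁[v] = Q₁[w]` (locality), hence
`Q[v] = Q[w] + Q₂[w] − Q₂[v]` with `|Q₂[w]|, |Q₂[v]| ≤ K′C₀²`
(`exists_bound_farPotential_scale_decay`, `exists_bound_farPotential_profile`), and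
`Q[w] = p̃[w]` (Tao (35)) with the tree's `L²` Calderón–Zygmund bound
`‖p̃[w]‖₂ ≤ C_S ‖|w|²‖₂` (`stein1970_normalisedPressure_eLpNorm_le_holds`). This is the pressure
input `∫∫_{Q₁}|p̃|^{3/2}` of the quantitative Serrin bootstrap for the rescaled cylinders of
Lemma 7.1. [cite: PineauVicol2026, Lemma 7.1 (proof, p. 24)] -/
theorem exists_local_pressure_mass_bound :
    ∃ K : ℝ, 0 ≤ K ∧ ∀ (v : ℝ³ → ℝ³) (C₀ s₀ : ℝ) (y₀ : ℝ³), ContDiff ℝ ∞ v → 0 < s₀ → ‖y₀‖ ≤ 16 →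
      16 ≤ ‖y₀‖ + s₀ → (∀ x, ‖v x‖ ≤ C₀ / (‖x - y₀‖ + s₀)) →
      Integrable (fun x => |pressurePotential v x| ^ 2) (volume.restrict (closedBall (0 : ℝ³) 1)) ∧
      ∫ x in closedBall (0 : ℝ³) 1, |pressurePotential v x| ^ 2 ≤ K * C₀ ^ 4 := by
  obtain ⟨Kf, hKf0, hKf⟩ := exists_bound_farPotential_profile
  obtain ⟨Kd, hKd0, hKd⟩ := exists_bound_farPotential_scale_decay
  obtain ⟨CS, hCS0, hCS⟩ := stein1970_normalisedPressure_eLpNorm_le_holds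
  set Vc : ℝ := volume.real (closedBall (0 : ℝ³) 1) with hVc
  have hVc0 : 0 ≤ Vc := measureReal_nonneg
  set V16 : ℝ := volume.real (closedBall (0 : ℝ³) 16) with hV16
  have hV160 : 0 ≤ V16 := measureReal_nonneg
  clear_value Vc V16
  refine ⟨3 * (CS ^ 2 * (8 : ℝ)⁻¹ ^ 4 * V16 + Vc * ((Kd * 16) ^ 2 + Kf ^ 2)), by positivity,
    fun v C₀ s₀ y₀ hv hs₀ hy₀ hys hvb => ?_⟩
  have hC : 0 ≤ C₀ := by
    have := (norm_nonneg _).trans (hvb y₀)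
    rw [sub_self, norm_zero, zero_add] at this
    exact (div_nonneg_iff.1 this).elim (fun h => h.1) fun h => absurd h.2 (not_le.2 hs₀)
  have hvc : Continuous v := hv.continuous
  have hv2 : ContDiff ℝ 2 v := hv.of_le (by norm_cast)
  -- the cut field `w = χ v`
  have hχs : ContDiff ℝ ∞ (cutoff (E := ℝ³) 4) := contDiff_cutoff 4
  have hχc : HasCompactSupport (cutoff (E := ℝ³) 4) := hasCompactSupport_cutoff (by norm_num)
  set w : ℝ³ → ℝ³ := fun y => cutoff 4 y • v y with hw
  clear_value w
  have hws : ContDiff ℝ ∞ w := by rw [hw]; exact hχs.smul hv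
  have hwc : HasCompactSupport w := by rw [hw]; exact hχc.smul_right
  have hw2 : ContDiff ℝ 2 w := hws.of_le (by norm_cast)
  have hwcont : Continuous w := hws.continuous
  -- `|w| ≤ C₀/8` and `w = 0` off `B̄₈`
  have hwb : ∀ y, ‖w y‖ ≤ C₀ / 8 := by
    intro y
    by_cases hy : ‖y‖ ≤ 8
    · have hden : 8 ≤ ‖y - y₀‖ + s₀ := by
        have : ‖y₀‖ ≤ ‖y‖ + ‖y - y₀‖ := by
          have := norm_sub_le y (y - y₀); rwa [sub_sub_cancel] at this
        linarith
      calc ‖w y‖ = |cutoff 4 y| * ‖v y‖ := by rw [hw]; exact norm_smul _ _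
        _ ≤ 1 * (C₀ / (‖y - y₀‖ + s₀)) := mul_le_mul (abs_cutoff_le_one _ _) (hvb y) (norm_nonneg _) zero_le_one
        _ ≤ C₀ / 8 := by rw [one_mul]; exact div_le_div_of_nonneg_left hC (by norm_num) hden
    · have : cutoff (E := ℝ³) 4 y = 0 := cutoff_eq_zero (by norm_num) (by linarith [not_le.1 hy])
      rw [hw]; dsimp only; rw [this, zero_smul, norm_zero]; positivity
  have hw0 : ∀ y, 8 < ‖y‖ → w y = 0 := fun y hy => by
    rw [hw]; dsimp only; rw [cutoff_eq_zero (by norm_num) (by linarith), zero_smul]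
  have hwdec : ∀ y, ‖w y‖ ≤ 4 * C₀ / (1 + ‖y‖) := by
    intro y
    by_cases hy : ‖y‖ ≤ 8
    · rw [le_div_iff₀ (by positivity)]
      calc ‖w y‖ * (1 + ‖y‖) ≤ C₀ / 8 * (1 + 8) := mul_le_mul (hwb y) (by linarith) (by positivity) (by positivity)
        _ ≤ 4 * C₀ := by linarith
    · rw [hw0 y (not_le.1 hy), norm_zero]; positivity
  -- the far parts on `B̄₁`
  have hQ2v : ∀ x ∈ closedBall (0 : ℝ³) 1, |farPotential 1 2 v x| ≤ Kf * C₀ ^ 2 :=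
    fun x hx => hKf v C₀ s₀ y₀ hvc hs₀ hy₀ hys hvb x hx
  have hQ2w : ∀ x, |farPotential 1 2 w x| ≤ Kd * (4 * C₀) ^ 2 := fun x => by
    have := hKd w (4 * C₀) hwcont hwdec 1 le_rfl x
    simpa using this
  -- locality of the near part on `B̄₁`: `v = w` on `B(x, 3) ⊆ B̄₄`
  have hQ1 : ∀ x ∈ closedBall (0 : ℝ³) 1, nearPotential 1 2 v x = nearPotential 1 2 w x := by
    intro x hx
    refine nearPotential_congr (r := 3) (by norm_num) fun y hy => ?_
    have hy4 : ‖y‖ ≤ 4 := by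
      rw [mem_ball, dist_eq_norm] at hy
      have := mem_closedBall_zero_iff.1 hx
      have := norm_le_norm_add_norm_sub' y x
      linarith
    rw [hw]; dsimp only; rw [cutoff_eq_one (by norm_num) hy4, one_smul]
  -- `Q[w] = p̃[w] ∈ L²` with the Calderón–Zygmund bound
  have hw2c : HasCompactSupport fun y => ‖w y‖ ^ 2 := hwc.norm.comp_left (g := fun t : ℝ => t ^ 2) (by norm_num)
  have hL2w : Integrable fun y => ‖w y‖ ^ 2 := (hwcont.norm.pow 2).integrable_of_hasCompactSupport hw2c
  have hQw : pressurePotential w = normalisedPressure w := (normalisedPressure_eq_pressurePotential' hw2 hL2w).symm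
  obtain ⟨hmem, hle⟩ := hCS w hws hwc
  have hN : MemLp (fun y => ‖w y‖ ^ 2) 2 volume := (hwcont.norm.pow 2).memLp_of_hasCompactSupport hw2c
  have hp2 : ∫ x, ‖normalisedPressure w x‖ ^ 2 ≤ CS ^ 2 * ∫ x, ‖(fun y => ‖w y‖ ^ 2) x‖ ^ 2 := by
    rw [← integral_norm_sq_eq_of_memLp_two hmem, ← integral_norm_sq_eq_of_memLp_two hN]
    have h1 : (eLpNorm (normalisedPressure w) 2 volume).toReal ≤ CS * (eLpNorm (fun y => ‖w y‖ ^ 2) 2 volume).toReal := by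
      have := ENNReal.toReal_mono (ENNReal.mul_ne_top ENNReal.ofReal_ne_top hN.eLpNorm_ne_top) hle
      rwa [ENNReal.toReal_mul, ENNReal.toReal_ofReal hCS0] at this
    calc (eLpNorm (normalisedPressure w) 2 volume).toReal ^ 2
        ≤ (CS * (eLpNorm (fun y => ‖w y‖ ^ 2) 2 volume).toReal) ^ 2 :=
          pow_le_pow_left₀ ENNReal.toReal_nonneg h1 2
      _ = CS ^ 2 * (eLpNorm (fun y => ‖w y‖ ^ 2) 2 volume).toReal ^ 2 := by ring
  -- `∫ ‖w‖⁴ ≤ (C₀/8)⁴ |B̄₁₆|`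
  have hnorm_eq : (fun x => ‖(fun y => ‖w y‖ ^ 2) x‖ ^ 2) = fun x => ‖w x‖ ^ 4 := by
    funext x; simp only [Real.norm_eq_abs, abs_pow, abs_norm]; ring
  rw [hnorm_eq] at hp2
  have hw4c : HasCompactSupport fun y => ‖w y‖ ^ 4 := hwc.norm.comp_left (g := fun t : ℝ => t ^ 4) (by norm_num)
  have hi4 : Integrable fun x => ‖w x‖ ^ 4 := (hwcont.norm.pow 4).integrable_of_hasCompactSupport hw4c
  have hfin : volume (closedBall (0 : ℝ³) 16) < ⊤ := measure_closedBall_lt_top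
  have hind : Integrable (fun x : ℝ³ => (C₀ / 8) ^ 4 * (closedBall (0 : ℝ³) 16).indicator (fun _ => (1 : ℝ)) x) :=
    ((integrableOn_const hfin.ne (C := (1 : ℝ))).integrable_indicator measurableSet_closedBall).const_mul _
  have hpt : ∀ x, ‖w x‖ ^ 4 ≤ (C₀ / 8) ^ 4 * (closedBall (0 : ℝ³) 16).indicator (fun _ => (1 : ℝ)) x := by
    intro x
    by_cases hx : x ∈ closedBall (0 : ℝ³) 16
    · rw [Set.indicator_of_mem hx, mul_one]
      exact pow_le_pow_left₀ (norm_nonneg _) (hwb x) 4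
    · have hx8 : 8 < ‖x‖ := by
        rw [mem_closedBall_zero_iff, not_le] at hx; linarith
      rw [hw0 x hx8, norm_zero, Set.indicator_of_notMem hx]; simp
  have hle4 := integral_mono hi4 hind hpt
  have heq : ∫ x, (C₀ / 8) ^ 4 * (closedBall (0 : ℝ³) 16).indicator (fun _ => (1 : ℝ)) x = (C₀ / 8) ^ 4 * V16 := by
    rw [integral_const_mul, integral_indicator measurableSet_closedBall, setIntegral_const, smul_eq_mul, mul_one, hV16]
  have hw4 : ∫ x, ‖w x‖ ^ 4 ≤ (C₀ / 8) ^ 4 * V16 := hle4.trans heq.le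
  -- `Q[v]` is continuous (decay class with a crude constant)
  have hvdec : ∀ x, ‖v x‖ ≤ 17 * C₀ / min s₀ 17 / (1 + ‖x‖) := by
    intro x
    have hm0 : 0 < min s₀ 17 := lt_min hs₀ (by norm_num)
    have hden0 : 0 < ‖x - y₀‖ + s₀ := by positivity
    have hkey : min s₀ 17 * (1 + ‖x‖) ≤ 17 * (‖x - y₀‖ + s₀) := by
      have h1 : 1 + ‖x‖ ≤ 17 + ‖x - y₀‖ := by
        have := norm_le_norm_add_norm_sub' x y₀; linarith
      have h2 : min s₀ 17 ≤ s₀ := min_le_left _ _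
      have h3 : min s₀ 17 ≤ 17 := min_le_right _ _
      nlinarith [norm_nonneg (x - y₀), hm0.le]
    rw [div_div, le_div_iff₀ (by positivity)]
    calc ‖v x‖ * (min s₀ 17 * (1 + ‖x‖)) ≤ C₀ / (‖x - y₀‖ + s₀) * (17 * (‖x - y₀‖ + s₀)) :=
          mul_le_mul (hvb x) hkey (by positivity) (by positivity)
      _ = 17 * C₀ := by field_simp
  have hQc : Continuous (pressurePotential v) := (contDiff_pressurePotential_decay (hv.of_le (by norm_cast)) hvdec).continuous
  have hQi : IntegrableOn (fun x => |pressurePotential v x| ^ 2) (closedBall (0 : ℝ³) 1) :=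
    ((continuous_abs.comp hQc).pow 2).continuousOn.integrableOn_compact (isCompact_closedBall 0 1)
  refine ⟨hQi, ?_⟩
  -- pointwise on `B̄₁`
  set c : ℝ := (Kd * (4 * C₀) ^ 2) ^ 2 + (Kf * C₀ ^ 2) ^ 2 with hc
  have hpt : ∀ x ∈ closedBall (0 : ℝ³) 1, |pressurePotential v x| ^ 2 ≤ 3 * ‖normalisedPressure w x‖ ^ 2 + 3 * c := by
    intro x hx
    have e1 : pressurePotential v x = pressurePotential w x + farPotential 1 2 w x - farPotential 1 2 v x := by
      simp only [pressurePotential, hQ1 x hx]; ring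
    have ha := hQ2w x
    have hb := hQ2v x hx
    rw [e1, hQw]
    have hsq : ∀ a b d : ℝ, |a + b - d| ^ 2 ≤ 3 * a ^ 2 + 3 * (b ^ 2 + d ^ 2) := fun a b d => by
      rw [sq_abs]; nlinarith [sq_nonneg (a - b), sq_nonneg (a + d), sq_nonneg (b + d)]
    refine (hsq _ _ _).trans ?_
    rw [Real.norm_eq_abs, sq_abs]
    have hb2 : (farPotential 1 2 w x) ^ 2 ≤ (Kd * (4 * C₀) ^ 2) ^ 2 := by
      rw [← sq_abs]; exact pow_le_pow_left₀ (abs_nonneg _) ha 2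
    have hd2 : (farPotential 1 2 v x) ^ 2 ≤ (Kf * C₀ ^ 2) ^ 2 := by
      rw [← sq_abs]; exact pow_le_pow_left₀ (abs_nonneg _) hb 2
    rw [hc]; linarith
  -- integrate over `B̄₁`
  have hVfin : volume (closedBall (0 : ℝ³) 1) < ⊤ := measure_closedBall_lt_top
  have hPi : Integrable fun x => ‖normalisedPressure w x‖ ^ 2 := (memLp_two_iff_integrable_sq_norm hmem.1).1 hmem
  have hsumi : IntegrableOn (fun x => 3 * ‖normalisedPressure w x‖ ^ 2 + 3 * c) (closedBall (0 : ℝ³) 1) :=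
    (hPi.const_mul 3).integrableOn.add (integrableOn_const hVfin.ne)
  have hint := setIntegral_mono_on hQi hsumi measurableSet_closedBall hpt
  have e2 : ∫ x in closedBall (0 : ℝ³) 1, (3 * ‖normalisedPressure w x‖ ^ 2 + 3 * c) =
      3 * (∫ x in closedBall (0 : ℝ³) 1, ‖normalisedPressure w x‖ ^ 2) + 3 * c * Vc := by
    rw [integral_add (hPi.const_mul 3).integrableOn (integrableOn_const hVfin.ne), integral_const_mul, setIntegral_const,
      smul_eq_mul, hVc]
    ring
  have hint' : ∫ x in closedBall (0 : ℝ³) 1, |pressurePotential v x| ^ 2 ≤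
      3 * (∫ x in closedBall (0 : ℝ³) 1, ‖normalisedPressure w x‖ ^ 2) + 3 * c * Vc := e2 ▸ hint
  have hP1 : ∫ x in closedBall (0 : ℝ³) 1, ‖normalisedPressure w x‖ ^ 2 ≤ ∫ x, ‖normalisedPressure w x‖ ^ 2 :=
    setIntegral_le_integral hPi (Eventually.of_forall fun x => sq_nonneg _)
  have hfinal : 3 * (∫ x in closedBall (0 : ℝ³) 1, ‖normalisedPressure w x‖ ^ 2) + 3 * c * Vc ≤
      3 * (CS ^ 2 * (8 : ℝ)⁻¹ ^ 4 * V16 + Vc * ((Kd * 16) ^ 2 + Kf ^ 2)) * C₀ ^ 4 := by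
    have h1 : ∫ x, ‖normalisedPressure w x‖ ^ 2 ≤ CS ^ 2 * ((C₀ / 8) ^ 4 * V16) :=
      hp2.trans (mul_le_mul_of_nonneg_left hw4 (sq_nonneg _))
    have h2 : c = ((Kd * 16) ^ 2 + Kf ^ 2) * C₀ ^ 4 := by rw [hc]; ring
    rw [h2]
    have : CS ^ 2 * ((C₀ / 8) ^ 4 * V16) = CS ^ 2 * (8 : ℝ)⁻¹ ^ 4 * V16 * C₀ ^ 4 := by ring
    nlinarith [hP1, h1, hVc0, sq_nonneg C₀, mul_nonneg hVc0 (by positivity : (0:ℝ) ≤ ((Kd * 16) ^ 2 + Kf ^ 2) * C₀ ^ 4)]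
  exact hint'.trans hfinal

end PineauVicol2026

end Literature.Analysis.FluidPDE
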